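import Mathlib
import Summits.ValiantsHypothesis.ValiantsHypothesis.Theorems.GaugeDescentTorusOrbitDescentTorus
import HarnessLib

/-!
# Route GaugeDescent — `TorusOrbitDescent`, Galois side: class functions of points, algebraic
# points of `ℚ`-varieties, a finite Galois field of definition (support for stmt-ValiantsHypothesis-6635)

Second helper file for the Hilbert-90 descent lemma `TorusOrbitDescent` (card Lemma D). A split
torus `T = (ℂˣ)^k` acts on `ℂ^m` through the weights `A : Fin k → Fin m → ℤ`,
`(t·y)_v = (∏_l t_l ^ A l v) · y_v`.

* `classFun A y` (plumbing def, any field `K`): the CLASS FUNCTION of a point `y ∈ K^m` — it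
  records the zero pattern of `y` (`Sum.inl v ↦ [y_v ≠ 0]`) and the values of all kernel-lattice
  monomials supported on the support of `y` (`Sum.inr u ↦ ∏_v y_v^{u_v}` if `u` vanishes off the
  support and `A u = 0`, else `0`). Two points in the same `T`-orbit have the same class function
  (`classFun_torus`); class functions commute with field homomorphisms (`map_classFun`), so the
  Galois group of a Galois extension `E/ℚ` acts on the class functions of `E`-points by acting on
  the points (`smul_classFun`). This replaces "Galois permutes the orbits" of the informal proof by
  the coarser, manifestly algebraic relation "same class function" (at most as many classes as
  orbits), which is all the counting needs.
* `exists_algebraic_zero` — a system of rational polynomial equations with a complex solution has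
  a solution in algebraic numbers (Zariski's lemma + `IsAlgClosed.lift`, as in
  `Literature…exists_complex_solution_of_charZero`).
* `exists_galois_intermediateField` — finitely many algebraic numbers lie in a finite Galois
  extension `E/ℚ` inside `ℂ` (adjoin the complex roots of the product of their minimal polynomials).

Honest framing: reusable Galois-descent plumbing for a conditional route; `VP ≠ VNP` is NOT proved
and nothing here is progress on it.

## References

* G. Berhuy, *An Introduction to Galois Cohomology and its Applications* (2010), Thm. III.8.15
  (Galois descent lemma), Prop. III.8.24 (Hilbert 90). [cite: Berhuy2010, Thm. III.8.15]
-/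

set_option linter.dupNamespace false

noncomputable section

namespace Summit.ValiantsHypothesis.ValiantsHypothesis.Theorems.GaugeDescent

open Finset MvPolynomial

variable {m k : ℕ}

/-! ### §1. Class functions -/

section ClassFun

open Classical in
/-- **Class function of a point** (plumbing for `TorusOrbitDescent`): for `y ∈ K^m`,
`classFun A y (Sum.inl v) = 0` or `1` according as `y_v = 0` or not, and
`classFun A y (Sum.inr u) = ∏_v y_v^{u_v}` if the integer vector `u` vanishes wherever `y` does and
lies in the kernel lattice (`Σ_v A l v · u_v = 0` for all `l`), and `0` otherwise. Points in one
`T`-orbit have equal class functions (`classFun_torus`). [folklore] -/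
def classFun {K : Type*} [Field K] (A : Fin k → Fin m → ℤ) (y : Fin m → K) :
    Fin m ⊕ (Fin m → ℤ) → K :=
  Sum.elim (fun v => if y v = 0 then 0 else 1)
    (fun u => if (∀ v, y v = 0 → u v = 0) ∧ (∀ l, ∑ v, A l v * u v = 0)
      then ∏ v, y v ^ u v else 0)

variable {K K' : Type*} [Field K] [Field K'] (A : Fin k → Fin m → ℤ)

/-- The zero-pattern component of the class function. [folklore] -/
theorem classFun_inl [DecidableEq K] (y : Fin m → K) (v : Fin m) :
    classFun A y (Sum.inl v) = if y v = 0 then 0 else 1 := by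
  simp only [classFun, Sum.elim_inl]
  congr 1

/-- The monomial component of the class function. [folklore] -/
theorem classFun_inr (y : Fin m → K) (u : Fin m → ℤ)
    [Decidable ((∀ v, y v = 0 → u v = 0) ∧ (∀ l, ∑ v, A l v * u v = 0))] :
    classFun A y (Sum.inr u) =
      if (∀ v, y v = 0 → u v = 0) ∧ (∀ l, ∑ v, A l v * u v = 0) then ∏ v, y v ^ u v else 0 := by
  simp only [classFun, Sum.elim_inr]
  congr 1

/-- The value of the class function at an admissible kernel-lattice vector is the monomial.
[folklore] -/
theorem classFun_inr_of (y : Fin m → K) {u : Fin m → ℤ} (hu : ∀ v, y v = 0 → u v = 0)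
    (hA : ∀ l, ∑ v, A l v * u v = 0) : classFun A y (Sum.inr u) = ∏ v, y v ^ u v := by
  classical
  rw [classFun_inr, if_pos ⟨hu, hA⟩]

/-- **Class functions commute with field homomorphisms**: `φ ∘ classFun A y = classFun A (φ ∘ y)`.
[folklore] -/
theorem map_classFun (φ : K →+* K') (y : Fin m → K) :
    φ ∘ classFun A y = classFun A (fun v => φ (y v)) := by
  classical
  funext w
  rcases w with v | u
  · simp only [Function.comp_apply, classFun_inl, map_eq_zero]
    split_ifs <;> simp
  · simp only [Function.comp_apply, classFun_inr, map_eq_zero]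
    split_ifs <;> simp [map_prod, map_zpow₀]

/-- Two points with the same image under an injective map of their class functions… concretely:
the class function of an `E`-point, read in `ℂ`, is the class function of the point read in `ℂ`
(`E ⊆ ℂ` an intermediate field). [folklore] -/
theorem coe_classFun (E : IntermediateField ℚ ℂ) (y : Fin m → E) :
    (fun w => ((classFun A y w : E) : ℂ)) = classFun A (fun v => ((y v : E) : ℂ)) :=
  map_classFun A (algebraMap E ℂ) y

/-- **The Galois group acts on class functions through the points**: `σ • classFun A y =
classFun A (σ ∘ y)` for `σ ∈ Gal(E/ℚ)` (pointwise action on functions). [folklore] -/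
theorem smul_classFun (E : IntermediateField ℚ ℂ) (σ : E ≃ₐ[ℚ] E) (y : Fin m → E) :
    σ • classFun A y = classFun A (fun v => σ (y v)) := by
  funext w
  rw [Pi.smul_apply, AlgEquiv.smul_def]
  exact congrFun (map_classFun A (σ : E →+* E) y) w

/-- **Points in one torus orbit have the same class function.** [folklore] -/
theorem classFun_torus (y : Fin m → ℂ) (t : Fin k → ℂˣ) :
    classFun A (fun v => ((∏ l, t l ^ A l v : ℂˣ) : ℂ) * y v) = classFun A y := by
  classical
  have hzero : ∀ v, ((∏ l, t l ^ A l v : ℂˣ) : ℂ) * y v = 0 ↔ y v = 0 := fun v =>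
    Units.mul_right_eq_zero _
  funext w
  rcases w with v | u
  · simp only [classFun_inl, hzero]
  · simp only [classFun_inr, hzero]
    split_ifs with h
    · rw [← prod_mul_distrib.symm.trans (prod_congr rfl fun v _ => (mul_zpow _ _ _).symm)]
      have hunit : (∏ v, (((∏ l, t l ^ A l v : ℂˣ) : ℂ)) ^ u v) = 1 := by
        rw [show (∏ v, (((∏ l, t l ^ A l v : ℂˣ) : ℂ)) ^ u v) =
            (((∏ v, (∏ l, t l ^ A l v) ^ u v : ℂˣ)) : ℂ) by push_cast; rfl]
        rw [prod_torus_zpow A t u]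
        simp [h.2]
      rw [hunit, one_mul]
    · rfl

end ClassFun

/-! ### §2. Algebraic points and a finite Galois field of definition -/

section Algebraic

/-- **A rational system with a complex solution has an algebraic solution** (Nullstellensatz /
Zariski's lemma: the kernel of `ℚ[x] → ℂ`, `x ↦ y₀`, is a proper ideal containing the system; a
maximal ideal above it has a residue field finite over `ℚ`, which embeds into `ℂ`). Adapted from
`Literature…exists_complex_solution_of_charZero`. [folklore] -/
theorem exists_algebraic_zero (S : Set (MvPolynomial (Fin m) ℚ)) (y₀ : Fin m → ℂ)
    (hy₀ : ∀ f ∈ S, aeval y₀ f = 0) :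
    ∃ z : Fin m → ℂ, (∀ v, IsAlgebraic ℚ (z v)) ∧ ∀ f ∈ S, aeval z f = 0 := by
  -- adapted from Literature/Computability/AlgebraicComplexity/BurgisserBooleanPartsA3Steps.lean
  let φ : MvPolynomial (Fin m) ℚ →ₐ[ℚ] ℂ := aeval y₀
  have hS : ∀ f ∈ S, f ∈ RingHom.ker φ.toRingHom := fun f hf => by
    rw [RingHom.mem_ker]
    exact hy₀ f hf
  obtain ⟨M, hM, hPM⟩ := Ideal.exists_le_maximal (RingHom.ker φ.toRingHom)
    (RingHom.ker_ne_top φ.toRingHom)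
  let L := MvPolynomial (Fin m) ℚ ⧸ M
  letI : Field L := Ideal.Quotient.field M
  haveI : Algebra.FiniteType ℚ L :=
    Algebra.FiniteType.of_surjective (Ideal.Quotient.mkₐ ℚ M) (Ideal.Quotient.mkₐ_surjective ℚ M)
  haveI : Module.Finite ℚ L := finite_of_finite_type_of_isJacobsonRing ℚ L
  haveI : Algebra.IsAlgebraic ℚ L := Algebra.IsAlgebraic.of_finite ℚ L
  let ψ : L →ₐ[ℚ] ℂ := IsAlgClosed.lift
  let z : Fin m → ℂ := fun j => ψ (Ideal.Quotient.mkₐ ℚ M (X j))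
  have hfg : (aeval z : MvPolynomial (Fin m) ℚ →ₐ[ℚ] ℂ) = ψ.comp (Ideal.Quotient.mkₐ ℚ M) :=
    MvPolynomial.algHom_ext fun j => by rw [AlgHom.comp_apply, aeval_X]
  refine ⟨z, fun v => (Algebra.IsAlgebraic.isAlgebraic _).algHom ψ, fun f hf => ?_⟩
  have hfM : Ideal.Quotient.mkₐ ℚ M f = 0 := by
    rw [Ideal.Quotient.mkₐ_eq_mk, Ideal.Quotient.eq_zero_iff_mem]
    exact hPM (hS f hf)
  rw [hfg, AlgHom.comp_apply, hfM, map_zero]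

/-- **Finitely many algebraic numbers lie in a finite Galois extension of `ℚ` inside `ℂ`**: adjoin
to `ℚ` all complex roots of the product of their minimal polynomials (a splitting field, hence
normal; separable in characteristic `0`). [folklore] -/
theorem exists_galois_intermediateField (z : Fin m → ℂ) (hz : ∀ v, IsAlgebraic ℚ (z v)) :
    ∃ E : IntermediateField ℚ ℂ, FiniteDimensional ℚ E ∧ IsGalois ℚ E ∧ ∀ v, z v ∈ E := by
  classical
  let p : Polynomial ℚ := ∏ v, minpoly ℚ (z v)
  have hint : ∀ v, IsIntegral ℚ (z v) := fun v => (hz v).isIntegral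
  have hp0 : p ≠ 0 := prod_ne_zero_iff.mpr fun v _ => minpoly.ne_zero (hint v)
  let E : IntermediateField ℚ ℂ := IntermediateField.adjoin ℚ (p.rootSet ℂ)
  haveI hsplit : p.IsSplittingField ℚ E :=
    IntermediateField.adjoin_rootSet_isSplittingField (IsAlgClosed.splits _)
  haveI : FiniteDimensional ℚ E := Polynomial.IsSplittingField.finiteDimensional E p
  haveI : Normal ℚ E := Normal.of_isSplittingField p
  refine ⟨E, inferInstance, isGalois_iff.mpr ⟨inferInstance, inferInstance⟩, fun v => ?_⟩
  refine IntermediateField.subset_adjoin ℚ (p.rootSet ℂ) ?_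
  rw [Polynomial.mem_rootSet]
  refine ⟨hp0, ?_⟩
  rw [map_prod]
  exact prod_eq_zero (mem_univ v) (minpoly.aeval ℚ (z v))

end Algebraic

end Summit.ValiantsHypothesis.ValiantsHypothesis.Theorems.GaugeDescent

end
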